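import Summits.QuantumFields.YangMills.Theorems.TwistedTraceScaling.ParityUnevenBlocking
import Literature.MathematicalPhysics.QuantumFieldTheory.BalabanFormatDensity
import Literature.RepresentationTheory.CompactGroups.UnitaryTrick

/-!
# Parity of the Wilson action and of blocked densities (helper for `LuscherReduction.TwistedTraceScaling`)

Sequel of `ParityUnevenBlocking` (count-neutral helper, `--supports stmt-QuantumFields-20203`; crux idea
`parity-valley-regularity` (B1) «evenness for free»):
* ★ `wilsonAction_linkReflect` — the Wilson action of any continuous matrix representation of a compact `G` is
  invariant under every axis parity `linkReflect L ν a` (plaquettes are permuted by the involution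
  `plaqReflect`; those containing `ν` pick up a conjugate-inverse holonomy, same real trace by the unitary trick);
* `measurePreserving_linkReflect` — parity preserves the product Haar measure `torusLinkHaar`;
* `hasBlockedDensity_self_of_semiconj` / `hasBlockedDensity_comp_of_semiconj` — abstract transfer: a blocking
  intertwining a measure- and weight-preserving symmetry of the fine torus with a map of the block torus pushes
  to a symmetric blocked density (Bałaban's renormalization transformation in the tree's weak form
  `HasBlockedDensity`, file `BalabanFormatDensity`);
* ★★ `hasBlockedDensity_unevenAxialLink_parity` and the unconditional Wilson case `hasBlockedDensity_wilson_parity`: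
  for `b (T-1) ≤ N`, EVERY blocked density `σ` of the Wilson weight through `unevenAxialLink b N T` has a
  parity-invariant block measure `σ dV`, and `σ ∘ π_T` is again a blocked density — in every axis direction.

HONEST FRAMING: as in `ParityUnevenBlocking` — helper-level, not a gap, not Clay.
-/

noncomputable section

open Literature.MathematicalPhysics.QuantumLattice
open Literature.MathematicalPhysics.QuantumFieldTheory

namespace Summit.QuantumFields.YangMills.Theorems.TwistedTraceScaling.ParityBlocking

variable {d : ℕ} {G : Type*} {L : ℕ} (ν : Fin d) (a : ZMod L)

/-! ### The Wilson action is parity invariant -/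

section Wilson

variable [Group G]

/-- `σ_a = (· + e_ν) ∘ σ_{a-1}`. -/
theorem siteReflect_eq_shift (x : Site d L) :
    siteReflect L ν a x = (siteReflect L ν (a - 1) x).shift ν := by
  funext i
  simp only [Site.shift, siteReflect, Pi.add_apply]
  by_cases hi : i = ν
  · subst hi; simp; ring
  · simp [hi]

/-- The induced map of plaquettes: a plaquette containing the direction `ν` goes to the reflected
plaquette (corner `σ_{a-1} x`, same plane), one orthogonal to `ν` is carried along (corner `σ_a x`). -/
def plaqReflect (L : ℕ) (ν : Fin d) (a : ZMod L) (p : Plaquette d L) : Plaquette d L :=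
  (if p.2.1.1 = ν ∨ p.2.1.2 = ν then siteReflect L ν (a - 1) p.1 else siteReflect L ν a p.1, p.2)

/-- `plaqReflect` is an involution. -/
theorem plaqReflect_plaqReflect (p : Plaquette d L) :
    plaqReflect L ν a (plaqReflect L ν a p) = p := by
  obtain ⟨x, q⟩ := p
  simp only [plaqReflect]
  split_ifs <;> simp [siteReflect_siteReflect]

/-- `plaqReflect` as a permutation of the plaquettes (an involution). -/
def plaqReflectEquiv (L : ℕ) (ν : Fin d) (a : ZMod L) : Equiv.Perm (Plaquette d L) :=
  Function.Involutive.toPerm (plaqReflect L ν a) (plaqReflect_plaqReflect ν a)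

open Literature.RepresentationTheory.CompactGroups in
/-- `Re tr ρ((πU)_p) = Re tr ρ(U_{ϑp})`: the holonomy of the reflected field around `p` is the
holonomy of `U` around the reflected plaquette (planes orthogonal to `ν`) or a conjugate of its
inverse (planes containing `ν`); real traces of a continuous representation of the compact group
agree on `g` and `g⁻¹` (`CompactGroup.re_trace_map_inv`, unitary trick). -/
theorem re_trace_plaquetteHolonomy_linkReflect [TopologicalSpace G] [IsTopologicalGroup G]
    [CompactSpace G] {n : ℕ} (ρ : G →* Matrix (Fin n) (Fin n) ℂ) (hρ : Continuous ρ)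
    (U : GaugeConfig d L G) (p : Plaquette d L) :
    (ρ (plaquetteHolonomy (linkReflect L ν a U) p.1 p.2.1.1 p.2.1.2)).trace.re =
      (ρ (plaquetteHolonomy U (plaqReflect L ν a p).1 (plaqReflect L ν a p).2.1.1
        (plaqReflect L ν a p).2.1.2)).trace.re := by
  obtain ⟨x, ⟨⟨i, j⟩, hij⟩⟩ := p
  simp only [plaqReflect]
  by_cases hi : i = ν
  · subst hi
    have hj : j ≠ i := (ne_of_lt hij).symm
    rw [if_pos (Or.inl rfl)]
    unfold plaquetteHolonomy
    rw [linkReflect_apply_self, linkReflect_apply_of_ne _ _ _ _ hj, linkReflect_apply_self,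
      linkReflect_apply_of_ne _ _ _ _ hj, siteReflect_shift_self, siteReflect_shift_of_ne _ _ hj,
      siteReflect_eq_shift i a x]
    set y := siteReflect L i (a - 1) x
    rw [show (U (y, i))⁻¹ * U (y, j) * ((U (y.shift j, i))⁻¹)⁻¹ * (U (y.shift i, j))⁻¹ =
        (U (y, i))⁻¹ * (U (y, i) * U (y.shift i, j) * (U (y.shift j, i))⁻¹ * (U (y, j))⁻¹)⁻¹ *
          ((U (y, i))⁻¹)⁻¹ by group,
      CompactGroup.trace_conj_eq, CompactGroup.re_trace_map_inv ρ hρ]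
  · by_cases hj : j = ν
    · subst hj
      rw [if_pos (Or.inr rfl)]
      unfold plaquetteHolonomy
      rw [linkReflect_apply_of_ne _ _ _ _ hi, linkReflect_apply_self,
        linkReflect_apply_of_ne _ _ _ _ hi, linkReflect_apply_self, siteReflect_shift_of_ne _ _ hi,
        siteReflect_shift_self, siteReflect_eq_shift j a x]
      set y := siteReflect L j (a - 1) x
      rw [show U (y.shift j, i) * (U (y.shift i, j))⁻¹ * (U (y, i))⁻¹ * ((U (y, j))⁻¹)⁻¹ =
          (U (y, j))⁻¹ * (U (y, i) * U (y.shift i, j) * (U (y.shift j, i))⁻¹ * (U (y, j))⁻¹)⁻¹ *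
            ((U (y, j))⁻¹)⁻¹ by group,
        CompactGroup.trace_conj_eq, CompactGroup.re_trace_map_inv ρ hρ]
    · rw [if_neg (by rintro (h | h) <;> contradiction)]
      unfold plaquetteHolonomy
      rw [linkReflect_apply_of_ne _ _ _ _ hi, linkReflect_apply_of_ne _ _ _ _ hj,
        linkReflect_apply_of_ne _ _ _ _ hi, linkReflect_apply_of_ne _ _ _ _ hj,
        siteReflect_shift_of_ne _ _ hi, siteReflect_shift_of_ne _ _ hj]

/-- ★ **The Wilson action is invariant under every axis parity**: `S_W(πU) = S_W(U)` — the sum over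
plaquettes is reindexed by the involution `plaqReflect`. Hence the Wilson weight `e^{-β S_W}` (and
every weight that is a function of it) satisfies the hypothesis `hw` of the measure-level theorems
below. -/
theorem wilsonAction_linkReflect [TopologicalSpace G] [IsTopologicalGroup G] [CompactSpace G]
    [NeZero L] {n : ℕ} (ρ : G →* Matrix (Fin n) (Fin n) ℂ) (hρ : Continuous ρ)
    (U : GaugeConfig d L G) : wilsonAction ρ (linkReflect L ν a U) = wilsonAction ρ U := by
  unfold wilsonAction
  simp_rw [re_trace_plaquetteHolonomy_linkReflect ν a ρ hρ U]
  exact Equiv.sum_comp (plaqReflectEquiv L ν a)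
    (fun p : Plaquette d L => ((n : ℝ) - (ρ (plaquetteHolonomy U p.1 p.2.1.1 p.2.1.2)).trace.re))

end Wilson

/-! ## Part II — measure level: the blocked densities of a parity-invariant weight are parity
invariant (Bałaban's `T` commutes with parity) -/

section MeasureLevel

open MeasureTheory

/-- The underlying map of links: `(x, ν) ↦ (σ_{a-1} x, ν)`, `(x, μ) ↦ (σ_a x, μ)` for `μ ≠ ν`. -/
def edgeReflect (L : ℕ) (ν : Fin d) (a : ZMod L) (e : Edge d L) : Edge d L :=
  if e.2 = ν then (siteReflect L ν (a - 1) e.1, ν) else (siteReflect L ν a e.1, e.2)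

/-- `edgeReflect` is an involution. -/
theorem edgeReflect_edgeReflect (e : Edge d L) : edgeReflect L ν a (edgeReflect L ν a e) = e := by
  obtain ⟨x, μ⟩ := e
  by_cases hμ : μ = ν
  · subst hμ; simp [edgeReflect, siteReflect_siteReflect]
  · simp [edgeReflect, hμ, siteReflect_siteReflect]

/-- `linkReflect` = relabel the links by `edgeReflect`, then invert the ones in direction `ν`. -/
theorem linkReflect_eq [Group G] (U : GaugeConfig d L G) (e : Edge d L) :
    linkReflect L ν a U e =
      if e.2 = ν then (U (edgeReflect L ν a e))⁻¹ else U (edgeReflect L ν a e) := by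
  obtain ⟨x, μ⟩ := e
  by_cases hμ : μ = ν
  · subst hμ; simp [linkReflect, edgeReflect]
  · simp [linkReflect, edgeReflect, hμ]

/-- `edgeReflect` as a permutation of the links (it is an involution). -/
def edgeReflectEquiv (L : ℕ) (ν : Fin d) (a : ZMod L) : Equiv.Perm (Edge d L) :=
  Function.Involutive.toPerm (edgeReflect L ν a) (edgeReflect_edgeReflect ν a)

variable [Group G] [MeasurableSpace G] [TopologicalSpace G] [IsTopologicalGroup G] [BorelSpace G]

/-- The parity of gauge fields is measurable. -/
theorem measurable_linkReflect :
    Measurable (linkReflect L ν a : GaugeConfig d L G → GaugeConfig d L G) := by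
  refine measurable_pi_lambda _ fun e => ?_
  simp only [linkReflect_eq]
  split_ifs
  · exact (measurable_pi_apply _).inv
  · exact measurable_pi_apply _

/-- The parity of gauge fields as a measurable equivalence (a measurable involution). -/
def linkReflectMEquiv (L : ℕ) (ν : Fin d) (a : ZMod L) : GaugeConfig d L G ≃ᵐ GaugeConfig d L G where
  toFun := linkReflect L ν a
  invFun := linkReflect L ν a
  left_inv := linkReflect_linkReflect ν a
  right_inv := linkReflect_linkReflect ν a
  measurable_toFun := measurable_linkReflect ν a
  measurable_invFun := measurable_linkReflect ν a

/-- Unfolding `linkReflectMEquiv`. -/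
@[simp] theorem linkReflectMEquiv_apply (U : GaugeConfig d L G) :
    linkReflectMEquiv (G := G) L ν a U = linkReflect L ν a U := rfl

variable [CompactSpace G]

/-- **Parity preserves the product Haar measure** `∏ₑ dU_e` of the torus: it relabels the links by
an involution and inverts those in direction `ν`, and the Haar probability measure of the compact
group `G` is inversion invariant (the tree's proof of `measurePreserving_timeReflect`, verbatim for a
general axis and centre). -/
theorem measurePreserving_linkReflect [NeZero L] :
    MeasurePreserving (linkReflect L ν a : GaugeConfig d L G → GaugeConfig d L G)
      (torusLinkHaar d G L) (torusLinkHaar d G L) := by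
  have h1 : MeasurePreserving
      (MeasurableEquiv.arrowCongr' (edgeReflectEquiv (d := d) L ν a) (MeasurableEquiv.refl G))
      (torusLinkHaar d G L) (torusLinkHaar d G L) :=
    measurePreserving_arrowCongr' (fun _ => haarProbability G) (fun _ => haarProbability G)
      (edgeReflectEquiv L ν a) (MeasurableEquiv.refl G) fun _ => MeasurePreserving.id _
  have h2 : MeasurePreserving
      (fun (V : GaugeConfig d L G) (e : Edge d L) =>
        (if e.2 = ν then (fun g : G => g⁻¹) else id) (V e))
      (torusLinkHaar d G L) (torusLinkHaar d G L) := by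
    refine measurePreserving_pi _ _ fun e => ?_
    split_ifs
    · exact Measure.measurePreserving_inv _
    · exact MeasurePreserving.id _
  have heq : (linkReflect L ν a : GaugeConfig d L G → GaugeConfig d L G) =
      (fun (V : GaugeConfig d L G) (e : Edge d L) =>
        (if e.2 = ν then (fun g : G => g⁻¹) else id) (V e)) ∘
      (MeasurableEquiv.arrowCongr' (edgeReflectEquiv (d := d) L ν a) (MeasurableEquiv.refl G)) := by
    funext U e
    have happ : (MeasurableEquiv.arrowCongr' (edgeReflectEquiv (d := d) L ν a)
        (MeasurableEquiv.refl G)) U e = U (edgeReflect L ν a e) := rfl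
    simp only [Function.comp_apply, linkReflect_eq, happ]
    split_ifs <;> rfl
  rw [heq]
  exact h2.comp h1

variable {Nf M : ℕ} [NeZero Nf] [NeZero M]

/-- **Blocked densities inherit intertwined symmetries** (abstract form).  If the blocking `Bl`
intertwines a symmetry `πf` of the fine torus (preserving `∏ dU_e` and the weight `w`) with a
measurable map `πb` of the block torus, `Bl ∘ πf = πb ∘ Bl`, then every blocked density `σ` of `w`
gives a `πb`-INVARIANT block measure `σ dV`: `∫ G(πb V) σ(V) dV = ∫ G(V) σ(V) dV` — in the tree's
language, `σ` is its own blocked density through `πb`. -/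
theorem hasBlockedDensity_self_of_semiconj {Bl : GaugeConfig d Nf G → GaugeConfig d M G}
    {w : GaugeConfig d Nf G → ℝ} {σ : GaugeConfig d M G → ℝ} (h : HasBlockedDensity Bl w σ)
    (πf : GaugeConfig d Nf G ≃ᵐ GaugeConfig d Nf G) {πb : GaugeConfig d M G → GaugeConfig d M G}
    (hπf : MeasurePreserving πf (torusLinkHaar d G Nf) (torusLinkHaar d G Nf)) (hπb : Measurable πb)
    (hBl : ∀ U, Bl (πf U) = πb (Bl U)) (hw : ∀ U, w (πf U) = w U) :
    HasBlockedDensity πb σ σ := by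
  intro Gf hGf hC
  obtain ⟨C, hC⟩ := hC
  have h1 := h (Gf ∘ πb) (hGf.comp hπb) ⟨C, fun V => hC _⟩
  have h2 := h Gf hGf ⟨C, hC⟩
  simp only [Function.comp_apply] at h1
  rw [← h1, ← h2]
  have h3 : ∫ U, Gf (Bl (πf U)) * w (πf U) ∂torusLinkHaar d G Nf =
      ∫ U, Gf (Bl U) * w U ∂torusLinkHaar d G Nf :=
    hπf.integral_comp' (fun U' => Gf (Bl U') * w U')
  simpa only [hBl, hw] using h3

/-- … and if `πb` is itself a `∏ dV_e`-preserving involution, the reflected density `σ ∘ πb` is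
again a blocked density of `w` (so it agrees with `σ` almost everywhere, blocked densities being
determined by the blocked-weight identity): **the renormalization transformation commutes with the
symmetry.** -/
theorem hasBlockedDensity_comp_of_semiconj {Bl : GaugeConfig d Nf G → GaugeConfig d M G}
    {w : GaugeConfig d Nf G → ℝ} {σ : GaugeConfig d M G → ℝ} (h : HasBlockedDensity Bl w σ)
    (πf : GaugeConfig d Nf G ≃ᵐ GaugeConfig d Nf G) (πb : GaugeConfig d M G ≃ᵐ GaugeConfig d M G)
    (hπf : MeasurePreserving πf (torusLinkHaar d G Nf) (torusLinkHaar d G Nf))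
    (hπb : MeasurePreserving πb (torusLinkHaar d G M) (torusLinkHaar d G M))
    (hπb2 : ∀ V, πb (πb V) = V)
    (hBl : ∀ U, Bl (πf U) = πb (Bl U)) (hw : ∀ U, w (πf U) = w U) :
    HasBlockedDensity Bl w (σ ∘ πb) := by
  intro Gf hGf hC
  obtain ⟨C, hC⟩ := hC
  have hinv := hasBlockedDensity_self_of_semiconj h πf hπf πb.measurable hBl hw Gf hGf ⟨C, hC⟩
  have h2 := h Gf hGf ⟨C, hC⟩
  rw [h2, ← hinv]
  have h3 : ∫ V, Gf (πb (πb V)) * σ (πb V) ∂torusLinkHaar d G M =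
      ∫ V, Gf (πb V) * σ V ∂torusLinkHaar d G M :=
    hπb.integral_comp' (fun V' => Gf (πb V') * σ V')
  rw [← h3]
  congr 1
  funext V
  simp only [Function.comp_apply, hπb2]

/-- ★★ **Parity of the blocked densities of the E1 tower** («evenness for free», card
`parity-valley-regularity` (B1), pre-vet (V7)).  Let `b (T-1) ≤ N` and let `w` be a weight on the
fine torus invariant under the parity `π_N = linkReflect N ν (b(T-1))` (e.g. the Wilson weight
`e^{-β S_W}`, or any function of plaquette traces symmetric under the lattice's point group).  Then
for every blocked density `σ` of `w` through the uneven axial blocking `Ū = unevenAxialLink b N T`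
(Bałaban's `(Tρ)(V) = ∫ dU δ(Ū(U) V⁻¹) ρ(U)` in the tree's weak form `HasBlockedDensity`):
(i) the block measure `σ dV` is invariant under the block parity `π_T = linkReflect T ν (T-1)`;
(ii) `σ ∘ π_T` is again a blocked density of `w` through `Ū`.
Iterating down the tower, every effective density is parity-even, in every axis direction `ν`. -/
theorem hasBlockedDensity_unevenAxialLink_parity {b N T : ℕ} [NeZero N] [NeZero T]
    (hN : b * (T - 1) ≤ N) (ν : Fin d) {w : GaugeConfig d N G → ℝ} {σ : GaugeConfig d T G → ℝ}
    (hw : ∀ U, w (linkReflect N ν ((b * (T - 1) : ℕ) : ZMod N) U) = w U)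
    (h : HasBlockedDensity (unevenAxialLink b N T) w σ) :
    HasBlockedDensity (linkReflect T ν ((T - 1 : ℕ) : ZMod T)) σ σ ∧
    HasBlockedDensity (unevenAxialLink b N T) w (σ ∘ linkReflect T ν ((T - 1 : ℕ) : ZMod T)) :=
  ⟨hasBlockedDensity_self_of_semiconj h (linkReflectMEquiv N ν _)
      (measurePreserving_linkReflect ν _) (measurable_linkReflect ν _)
      (unevenAxialLink_linkReflect hN ν) hw,
   hasBlockedDensity_comp_of_semiconj h (linkReflectMEquiv N ν _) (linkReflectMEquiv T ν _)
      (measurePreserving_linkReflect ν _) (measurePreserving_linkReflect ν _)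
      (linkReflect_linkReflect ν _) (unevenAxialLink_linkReflect hN ν) hw⟩

/-- ★★ **The Wilson case, unconditionally**: for the Wilson weight `e^{-β S_W}` of a continuous
matrix representation `ρ` of the compact group `G` (hypothesis `hw` discharged by
`wilsonAction_linkReflect`), every blocked density through the uneven axial blocking is parity
invariant in the sense (i) ∧ (ii), in every axis direction. -/
theorem hasBlockedDensity_wilson_parity {b N T : ℕ} [NeZero N] [NeZero T]
    (hN : b * (T - 1) ≤ N) (ν : Fin d) {n : ℕ} (ρ : G →* Matrix (Fin n) (Fin n) ℂ)
    (hρ : Continuous ρ) (β : ℝ) {σ : GaugeConfig d T G → ℝ}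
    (h : HasBlockedDensity (unevenAxialLink b N T) (fun U => Real.exp (-β * wilsonAction ρ U)) σ) :
    HasBlockedDensity (linkReflect T ν ((T - 1 : ℕ) : ZMod T)) σ σ ∧
    HasBlockedDensity (unevenAxialLink b N T) (fun U => Real.exp (-β * wilsonAction ρ U))
      (σ ∘ linkReflect T ν ((T - 1 : ℕ) : ZMod T)) :=
  hasBlockedDensity_unevenAxialLink_parity hN ν
    (fun U => by simp only [wilsonAction_linkReflect _ _ ρ hρ]) h

end MeasureLevel

end Summit.QuantumFields.YangMills.Theorems.TwistedTraceScaling.ParityBlocking
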